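import Summits.QuantumFields.YangMills.Theorems.BalabanUVNodesN07DPrimeReachDictionary
import Summits.QuantumFields.YangMills.Theorems.BalabanUVNodesK0FlatCubeOpsTextP
import HarnessLib

/-!
# N07 [B11] ∕ K0⁷ road, chart side — MODULE 107: **THE TRUNCATED POTENTIAL `Ã = 𝟙_{π″□₀}·A` HAS THE SUPPLIER's GLOBAL WEIGHTED ROWS AND THE HEAD TOKEN's SLICE ROWS** — from the
# head token's (T2) tower letters `|A| < κε·L^{k′−j′}` on `π″□_{j′}`: `w₁(b)·‖Ã b‖ ≤ κεL` and `w₂(b)·‖Ã(b+e_ν) − Ã b‖ ≤ 2κεL` at EVERY bond of the torus (`w_m = (L^{j(b₋)}η)^m` the (152)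
# level weights of the per-cube meet, k0-s1's `IsLevWeight`); and `R∂*Ã = R∂*A` (the difference lives on bonds with pinned site stencils, MODULE 76)

Cell `pub-ymgap`, seat `pub-ymgap-dag-n07-e` g29 (FAN-OUT §N07 row s3; LANE OWNER of the K0 road chart side), MODULE 107 = repair (R3)(f) of ⚑ LOCATED-DPRIME-CALIBRATION (desk memo
+ `DPRIME-LAM-ROADMAP.md` §3 «KEY DESIGN POINT»).  `--kind proof --supports stmt-QuantumFields-20541 --as helper` (K0⁷); count-neutral; theorems only.
[15] = [Balaban1985Variational]; [6] = [Balaban1985RegularSpaces]; [4] = [Balaban1984PropagatorsII].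

WHY.  The supplier of the (d′) letter (k0-s1 S4, cell-form re-cut S4-Lam) asks GLOBAL weighted rows of the chart parameter (`∀ b, w 1 b·‖X b‖ ≤ ρ′`, `∀ b ν, w 2 b·Lᵏ·‖X(b+e_ν) − X b‖ ≤ ρ′`,
`w` = `IsLevWeight` of the family: `w m b = (L^{levOf b₋}·L^{−k})^m > 0` at EVERY bond) and a GLOBAL reading `U₁ = e^{iη(…)}`, while the head token's letters live on the tower only.  The
bridge is the truncation `Ã := 𝟙_{R₀}·A`, `R₀ = (regionOfSet (π″□₀)).bonds`: (i) a bond `b` whose source has meet-level `j ≥ 1` has `b₋ ∈ π″□_j` (MODULE 104's deck translation), hence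
`b`, and every bond within two lattice steps, lies in `π″□_{j−1}` (margin `m_j + 2 ≤ m_{j−1}`, [6] p. 98), where (T2) gives `|A| < κεL^{k−j+1}`; with `w₁ = L^{j−k}` this is `κεL`, with
`w₂ = L^{2(j−k)}` the crude gradient bound `2κεL^{k−j+1}` becomes `2κεL^{j−k+1} ≤ 2κεL`; level `0` reads (T2) on `π″□₀` directly; off `R₀`, `Ã = 0`.  (ii) `A − Ã` is carried by bonds
with an end off `π″□₀`, whose site stencils are pinned (MODULE 106 `siteStencil_pinned_of_not_reach`), so `R∂*(A − Ã) = 0` (MODULE 76 `RE_dsE_eq_zero_of_pinned_sites`) — the (153) slice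
rows of the head token pass from `A` to `Ã` (then to `Ã + H·Z` by MODULE 105).

WHAT IS PROVED (sorry-free; no definition; axioms standard; tower `a M ρ k hk`, `k ≤ m + K`, collar `ρ ≥ 2` (§3: `1 ≤ k`); meet `cubeDomains ⊓ D₂`).  §1 `margin_pred_add_le` (`m_j + t ≤ m_{j−1}` for
`t ≤ ρL^{j−1}`), `mem_cube_pred_of_within`, ★ `mem_bonds_pred_of_inOm` (a bond within two steps of a source whose `j`-block is a cube label, `j ≥ 1`, lies in `(regionOfSet (π″□_{j−1})).bonds`),
`inOm_cube_levOf`, `levWeight_one_mul_pow`, `levWeight_two_mul_pow_le` (the weight arithmetic); §2 `truncation_rows_of_T2_aux` (abstract level function), ★★★ `truncation_rows_of_T2` (the two global rows of `Ã` from (T2)); §3 ★★ `RE_dsE_truncation_eq`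
(`R∂*` of any real row agreeing with `A`'s on `(regionOfSet (π″□₀)).bonds` equals that of `A` — in particular for `Ã`).
HONEST FRAMING: lattice bookkeeping + real arithmetic by name; NOTHING of [15]'s estimates asserted; (d′) ∕ `HThm4RecDbar` ∕ budget row of MODULE 100 untouched; K0⁷ NOT closed; N07 NOT
discharged; counts unmoved; one finite 𝕋⁴ programme at fixed ε — NOT continuum ∕ ℝ⁴ ∕ OS ∕ mass gap ∕ Clay.  No `sorry`, no `def`, no `instance`, no `notation`.

References: [15] (152)–(153) p.301, (157)–(159) pp.302–303, p.286; [6] p.98, (1.131) p.99; [4] (2.3) p.224, (2.9)–(2.12) pp.224–225.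
-/

set_option autoImplicit false

noncomputable section

open scoped BigOperators

namespace Summit.QuantumFields.YangMills.BalabanUVNodes.N07DPrimeTruncationRows

open Literature.MathematicalPhysics.QuantumFieldTheory.Balaban1983to89
open Literature.MathematicalPhysics.QuantumFieldTheory.Balaban1983to89.B5Eq118OneStroke (iterBlockOf)
open Literature.MathematicalPhysics.QuantumFieldTheory.Balaban1983to89.B6SectADomainsV1 (Domains)
open Literature.MathematicalPhysics.QuantumFieldTheory.Balaban1983to89.B6SectAOperatorsV1 (BondIdx RE dsE)
open Literature.MathematicalPhysics.QuantumFieldTheory.BalabanImbrieJaffe1984to88.BIJ85AxialPropagator411 (BondSpace)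
open Literature.MathematicalPhysics.QuantumFieldTheory.Balaban1983to89.B14DomainGeom (Pt Within)
open Literature.MathematicalPhysics.QuantumFieldTheory.Balaban1983to89.B15Eq112TorusCover (cover lift cover_lift)
open Literature.MathematicalPhysics.QuantumFieldTheory.Balaban1983to89.B8Eq131Cubes (cube gs cube_eq cube_anti bLo bHi margin_succ)
open Literature.MathematicalPhysics.QuantumFieldTheory.Balaban1983to89.B11Eq115Space (levOf levOf_le mem_levOf)
open Literature.MathematicalPhysics.QuantumFieldTheory.Balaban1983to89.Node00
open Summit.QuantumFields.YangMills.Theorems.N21ReadSetSupport (within_add_single within_sub_single eq_of_shift_eq)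
open Summit.QuantumFields.YangMills.BalabanUVNodes.N07CritLamTowerClauses (exists_mem_cube_cover_eq_of_inOm mem_cube_zero_of_within margin_one_add_le)
open Summit.QuantumFields.YangMills.BalabanUVNodes.N07DPrimeReachDictionary (siteStencil_pinned_of_not_reach)
open Summit.QuantumFields.YangMills.Theorems.K0FlatCubeOpsTextP (IsLevWeight levWeight_nonneg)
open Summit.QuantumFields.YangMills.Theorems.K0FlatHPinnedExteriorLocality (RE_dsE_eq_zero_of_pinned_sites)

variable {P : Params} {a : Pt P.d} {M ρ k : ℕ} {hk : k ≤ P.m + P.K}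

/-! ## §1  Geometry: one level down, and the weight arithmetic -/

/-- `m_j + t ≤ m_{j−1}` for `1 ≤ j ≤ k` and `t ≤ ρL^{j−1}` (`m_{j−1} = m_j + ρL^{j−1}`, [6] p. 98). [cite: Balaban1985RegularSpaces, p.98] -/
theorem margin_pred_add_le {j t : ℕ} (hj : 1 ≤ j) (hjk : j ≤ k) (ht : t ≤ ρ * P.L ^ (j - 1)) :
    P.L ^ j * (ρ * gs P.L (k - j)) + t ≤ P.L ^ (j - 1) * (ρ * gs P.L (k - (j - 1))) := by
  obtain ⟨i, rfl⟩ : ∃ i, j = i + 1 := ⟨j - 1, by omega⟩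
  have h := margin_succ (L := P.L) (ρ := ρ) (k := k) (j := i) (by omega)
  simp only [Nat.add_sub_cancel] at ht ⊢
  omega

/-- **ONE LEVEL DOWN**: a point within sup-distance `t` of `□_j` lies in `□_{j−1}` when `m_j + t ≤ m_{j−1}`. [cite: Balaban1985RegularSpaces, p.98] -/
theorem mem_cube_pred_of_within {j t : ℕ} (hj : 1 ≤ j) (hjk : j ≤ k) (hmargin : P.L ^ j * (ρ * gs P.L (k - j)) + t ≤ P.L ^ (j - 1) * (ρ * gs P.L (k - (j - 1))))
    {z z' : Pt P.d} (hz : z ∈ cube P.L a M ρ k j) (hw : Within (t : ℤ) z z') : z' ∈ cube P.L a M ρ k (j - 1) := by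
  rw [cube_eq hjk] at hz
  rw [cube_eq (show j - 1 ≤ k by omega)]
  have hm : (((P.L ^ j * (ρ * gs P.L (k - j)) : ℕ) : ℤ) + (t : ℤ)) ≤ ((P.L ^ (j - 1) * (ρ * gs P.L (k - (j - 1))) : ℕ) : ℤ) := by exact_mod_cast hmargin
  intro i
  obtain ⟨h1, h2⟩ := hz i
  have h3 := abs_le.1 (hw i)
  simp only [bLo, bHi] at h1 h2 ⊢
  constructor <;> push_cast at h1 h2 hm ⊢ <;> linarith [h3.1, h3.2]

/-- ★ **A BOND WITHIN TWO STEPS OF A SOURCE OF MEET-LEVEL `j ≥ 1` LIES IN `(regionOfSet (π″□_{j−1})).bonds`**: if the `j`-block of `x` is a label of `Ω_j^{(j)}` of the cube family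
(`1 ≤ j ≤ k`, `ρ ≥ 2`) and `b` is a bond both of whose ends are cover points within `2` of a cover point of `x`… stated for the two shapes in use: `b = ⟨x, μ⟩` and `b = ⟨x + e_ν, μ⟩`.
[cite: Balaban1985RegularSpaces, p.98, (1.131) p.99; Balaban1985Variational, (152) p.301] -/
theorem mem_bonds_pred_of_inOm {j : ℕ} (hj : 1 ≤ j) (hjk : j ≤ k) (hρ : 2 ≤ ρ) {x : Site P 0} (hx : (cubeDomains P a M ρ k hk).InOm j x)
    (μ : Fin P.d) :
    (⟨x, μ⟩ : PBond P 0) ∈ (Sect2.regionOfSet P (cover P '' cube P.L a M ρ k (j - 1))).bonds ∧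
      ∀ ν : Fin P.d, (⟨x.shift ν, μ⟩ : PBond P 0) ∈ (Sect2.regionOfSet P (cover P '' cube P.L a M ρ k (j - 1))).bonds := by
  obtain ⟨z, hz, hzx⟩ := exists_mem_cube_cover_eq_of_inOm (hk := hk) hj hjk hx
  have hq : 1 ≤ P.L ^ (j - 1) := Nat.one_le_pow _ _ P.L_pos
  have hm : P.L ^ j * (ρ * gs P.L (k - j)) + 2 ≤ P.L ^ (j - 1) * (ρ * gs P.L (k - (j - 1))) :=
    margin_pred_add_le hj hjk (by nlinarith)
  -- every cover point within `2` of `z` lies in `□_{j−1}`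
  have hin : ∀ z' : Pt P.d, Within ((2 : ℕ) : ℤ) z z' → cover P z' ∈ cover P '' cube P.L a M ρ k (j - 1) :=
    fun z' hw => ⟨z', mem_cube_pred_of_within hj hjk hm hz hw, rfl⟩
  have h0 : Within ((2 : ℕ) : ℤ) z z := Within.refl (by norm_num) z
  have h1 : ∀ ν : Fin P.d, Within ((2 : ℕ) : ℤ) z (z + Pi.single ν 1) := fun ν =>
    Within.mono (by norm_num) (within_add_single z ν zero_le_one)
  have h2 : ∀ ν ν' : Fin P.d, Within ((2 : ℕ) : ℤ) z (z + Pi.single ν 1 + Pi.single ν' 1) := fun ν ν' => by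
    have := (within_add_single z ν zero_le_one).triangle (within_add_single (z + Pi.single ν 1) ν' zero_le_one)
    push_cast at this ⊢; exact this
  have ex : cover P z = x := hzx
  have eν : ∀ ν : Fin P.d, cover P (z + Pi.single ν 1) = x.shift ν := fun ν => by rw [B15Claim189CubePin.cover_add_single, hzx]
  have eνν : ∀ ν ν' : Fin P.d, cover P (z + Pi.single ν 1 + Pi.single ν' 1) = (x.shift ν).shift ν' := fun ν ν' => by
    rw [B15Claim189CubePin.cover_add_single, B15Claim189CubePin.cover_add_single, hzx]
  refine ⟨⟨ex ▸ hin z h0, ?_⟩, fun ν => ⟨(eν ν) ▸ hin _ (h1 ν), ?_⟩⟩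
  · show (⟨x, μ⟩ : PBond P 0).src.shift μ ∈ _
    exact (eν μ) ▸ hin _ (h1 μ)
  · show (x.shift ν).shift μ ∈ _
    exact (eνν ν μ) ▸ hin _ (h2 ν μ)

/-- The level of a fine site for the meet family lies in the standing range and the site lies in the cube family's region of that level. [cite: Balaban1985Variational, p.286, (152) p.301] -/
theorem inOm_cube_levOf (D₂ : Domains P) (x : Site P 0) :
    levOf (fun j => {y : Site P 0 | (domainsMeet (cubeDomains P a M ρ k hk) D₂).InOm j y}) k x ≤ k ∧
      (cubeDomains P a M ρ k hk).InOm (levOf (fun j => {y : Site P 0 | (domainsMeet (cubeDomains P a M ρ k hk) D₂).InOm j y}) k x) x := by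
  refine ⟨levOf_le _ _ _, ?_⟩
  have h := mem_levOf (Ω := fun j => {y : Site P 0 | (domainsMeet (cubeDomains P a M ρ k hk) D₂).InOm j y})
    (fun y => Domains.inOm_zero _ y) k x
  -- `InOm_meet j x → InOm_cube j x`
  exact domainsMeet_le_left _ _ _ h

/-- Weight arithmetic, first row: `L^{j}·L^{−k}·L^{k−j+1} = L` (`j ≤ k`). [folklore] -/
theorem levWeight_one_mul_pow {j : ℕ} (hjk : j ≤ k) :
    ((P.L : ℝ) ^ j * ((P.L : ℝ)⁻¹) ^ k) * (P.L : ℝ) ^ (k - j + 1) = P.L := by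
  have hL : (P.L : ℝ) ≠ 0 := Nat.cast_ne_zero.2 P.L_pos.ne'
  have hjk' : (P.L : ℝ) ^ j * (P.L : ℝ) ^ (k - j) = (P.L : ℝ) ^ k := by rw [← pow_add, Nat.add_sub_cancel' hjk]
  rw [inv_pow, show k - j + 1 = (k - j) + 1 from rfl, pow_succ,
    show (P.L : ℝ) ^ j * ((P.L : ℝ) ^ k)⁻¹ * ((P.L : ℝ) ^ (k - j) * (P.L : ℝ)) = ((P.L : ℝ) ^ j * (P.L : ℝ) ^ (k - j)) * ((P.L : ℝ) ^ k)⁻¹ * (P.L : ℝ) by ring,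
    hjk', mul_inv_cancel₀ (pow_ne_zero _ hL), one_mul]

/-- Weight arithmetic, second row: `(L^{j}·L^{−k})²·L^{k−j+1} = L^{j+1}·L^{−k} ≤ L` (`j ≤ k`, `L ≥ 1`). [folklore] -/
theorem levWeight_two_mul_pow_le {j : ℕ} (hjk : j ≤ k) :
    ((P.L : ℝ) ^ j * ((P.L : ℝ)⁻¹) ^ k) ^ 2 * (P.L : ℝ) ^ (k - j + 1) ≤ P.L := by
  have hL : (0 : ℝ) < P.L := Nat.cast_pos.2 P.L_pos
  have hL1 : (1 : ℝ) ≤ P.L := by exact_mod_cast P.L_pos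
  have h1 : ((P.L : ℝ) ^ j * ((P.L : ℝ)⁻¹) ^ k) ^ 2 * (P.L : ℝ) ^ (k - j + 1) =
      ((P.L : ℝ) ^ j * ((P.L : ℝ)⁻¹) ^ k) * (((P.L : ℝ) ^ j * ((P.L : ℝ)⁻¹) ^ k) * (P.L : ℝ) ^ (k - j + 1)) := by ring
  rw [h1, levWeight_one_mul_pow hjk]
  -- `L^{j}·L^{−k} ≤ 1`
  have h2 : (P.L : ℝ) ^ j * ((P.L : ℝ)⁻¹) ^ k ≤ 1 := by
    rw [inv_pow]
    rw [mul_inv_le_iff₀ (pow_pos hL k), one_mul]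
    exact pow_le_pow_right₀ hL1 hjk
  calc (P.L : ℝ) ^ j * ((P.L : ℝ)⁻¹) ^ k * (P.L : ℝ) ≤ 1 * (P.L : ℝ) := by
        exact mul_le_mul_of_nonneg_right h2 hL.le
    _ = P.L := one_mul _

/-! ## §2  The two global rows of the truncation from (T2) -/

/-- **The two rows, for an abstract level function** `lev` with `lev x ≤ k`, `x ∈ Ω_{lev x}` of the cube family, and weights `w m b = (L^{lev b₋}·L^{−k})^m`.
[cite: Balaban1985Variational, (152) p.301, p.286; Balaban1985RegularSpaces, p.98] -/
theorem truncation_rows_of_T2_aux (hρ : 2 ≤ ρ) (lev : Site P 0 → ℕ) (hlevk : ∀ x, lev x ≤ k)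
    (hlevin : ∀ x, (cubeDomains P a M ρ k hk).InOm (lev x) x) {w : ℕ → PBond P 0 → ℝ}
    (hw : ∀ m b, w m b = ((P.L : ℝ) ^ lev b.src * ((P.L : ℝ)⁻¹) ^ k) ^ m)
    {V : Type*} [SeminormedAddCommGroup V] {A At : PBond P 0 → V} {κε : ℝ} (hκε : 0 ≤ κε)
    (hT2 : ∀ j', j' ≤ k → ∀ b ∈ (Sect2.regionOfSet P (cover P '' cube P.L a M ρ k j')).bonds, ‖A b‖ < κε * (P.L : ℝ) ^ (k - j'))
    (hin : ∀ b ∈ (Sect2.regionOfSet P (cover P '' cube P.L a M ρ k 0)).bonds, At b = A b)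
    (hout : ∀ b ∉ (Sect2.regionOfSet P (cover P '' cube P.L a M ρ k 0)).bonds, At b = 0) :
    (∀ b : PBond P 0, w 1 b * ‖At b‖ ≤ κε * P.L) ∧
      (∀ (b : PBond P 0) (ν : Fin P.d), w 2 b * ‖At ⟨b.src.shift ν, b.dir⟩ - At b‖ ≤ 2 * (κε * P.L)) := by
  have hL1 : (1 : ℝ) ≤ P.L := by exact_mod_cast P.L_pos
  have hL0 : (0 : ℝ) ≤ P.L := by positivity
  -- KEY BOUND: every bond issuing from `x` or from a neighbour `x + e_ν` carries `‖Ã‖ ≤ κε·L^{k − lev x + 1}`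
  have key : ∀ (x : Site P 0) (b' : PBond P 0), (b'.src = x ∨ ∃ ν : Fin P.d, b'.src = x.shift ν) →
      ‖At b'‖ ≤ κε * (P.L : ℝ) ^ (k - lev x + 1) := by
    intro x b' hb'
    by_cases hR : b' ∈ (Sect2.regionOfSet P (cover P '' cube P.L a M ρ k 0)).bonds
    · rw [hin b' hR]
      rcases Nat.eq_zero_or_pos (lev x) with h0 | hpos
      · -- level `0`: read (T2) on `π″□₀`
        have h := hT2 0 (Nat.zero_le k) b' hR
        rw [Nat.sub_zero] at h
        have hle : κε * (P.L : ℝ) ^ k ≤ κε * (P.L : ℝ) ^ (k - lev x + 1) := by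
          rw [h0, Nat.sub_zero]
          exact mul_le_mul_of_nonneg_left (pow_le_pow_right₀ hL1 (Nat.le_succ k)) hκε
        exact h.le.trans hle
      · -- level `j ≥ 1`: the bond lies in `(regionOfSet (π″□_{j−1})).bonds`
        obtain ⟨h1, h2⟩ := mem_bonds_pred_of_inOm (hk := hk) hpos (hlevk x) hρ (hlevin x) b'.dir
        have hb'mem : b' ∈ (Sect2.regionOfSet P (cover P '' cube P.L a M ρ k (lev x - 1))).bonds := by
          rcases hb' with h | ⟨ν, h⟩
          · have : b' = ⟨x, b'.dir⟩ := by cases b'; simp only at h; subst h; rfl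
            rw [this]; exact h1
          · have : b' = ⟨x.shift ν, b'.dir⟩ := by cases b'; simp only at h; subst h; rfl
            rw [this]; exact h2 ν
        have hk' : lev x - 1 ≤ k := by have := hlevk x; omega
        have h := hT2 (lev x - 1) hk' b' hb'mem
        have hexp : k - (lev x - 1) = k - lev x + 1 := by have := hlevk x; omega
        rw [hexp] at h
        exact h.le
    · rw [hout b' hR, norm_zero]
      positivity
  refine ⟨fun b => ?_, fun b ν => ?_⟩
  · -- first row
    have hw0 : 0 ≤ w 1 b := by rw [hw 1 b]; positivity
    calc w 1 b * ‖At b‖ ≤ w 1 b * (κε * (P.L : ℝ) ^ (k - lev b.src + 1)) :=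
          mul_le_mul_of_nonneg_left (key b.src b (Or.inl rfl)) hw0
      _ = κε * (((P.L : ℝ) ^ lev b.src * ((P.L : ℝ)⁻¹) ^ k) * (P.L : ℝ) ^ (k - lev b.src + 1)) := by rw [hw 1 b, pow_one]; ring
      _ = κε * P.L := by rw [levWeight_one_mul_pow (hlevk b.src)]
  · -- second row: crude gradient bound
    have hw0 : 0 ≤ w 2 b := by rw [hw 2 b]; positivity
    have hA1 := key b.src ⟨b.src.shift ν, b.dir⟩ (Or.inr ⟨ν, rfl⟩)
    have hA2 := key b.src b (Or.inl rfl)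
    have hdiff : ‖At ⟨b.src.shift ν, b.dir⟩ - At b‖ ≤ 2 * (κε * (P.L : ℝ) ^ (k - lev b.src + 1)) :=
      (norm_sub_le _ _).trans (by linarith)
    calc w 2 b * ‖At ⟨b.src.shift ν, b.dir⟩ - At b‖ ≤ w 2 b * (2 * (κε * (P.L : ℝ) ^ (k - lev b.src + 1))) :=
          mul_le_mul_of_nonneg_left hdiff hw0
      _ = 2 * κε * ((((P.L : ℝ) ^ lev b.src * ((P.L : ℝ)⁻¹) ^ k) ^ 2) * (P.L : ℝ) ^ (k - lev b.src + 1)) := by rw [hw 2 b]; ring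
      _ ≤ 2 * κε * P.L := mul_le_mul_of_nonneg_left (levWeight_two_mul_pow_le (hlevk b.src)) (by positivity)
      _ = 2 * (κε * P.L) := by ring

/-- ★★★ **THE TRUNCATION `Ã = 𝟙_{π″□₀}·A` HAS THE SUPPLIER's TWO GLOBAL WEIGHTED ROWS** (tower `k ≤ m + K`, collar `ρ ≥ 2`; `w` the (152) level weights of the meet `cubeDomains ⊓ D₂`,
k0-s1's `IsLevWeight`): from the head token's (T2) letters `‖A b‖ < κε·L^{k−j′}` on `(regionOfSet (π″□_{j′})).bonds`, `j′ ≤ k`, every bond of the torus satisfies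
`w 1 b·‖Ã b‖ ≤ κε·L` and `w 2 b·‖Ã(b + e_ν) − Ã b‖ ≤ 2κε·L`. [cite: Balaban1985Variational, (152) p.301, p.286; Balaban1985RegularSpaces, p.98] -/
theorem truncation_rows_of_T2 (D₂ : Domains P) (hρ : 2 ≤ ρ) {w : ℕ → PBond P 0 → ℝ}
    (hw : IsLevWeight P k (domainsMeet (cubeDomains P a M ρ k hk) D₂) w)
    {V : Type*} [SeminormedAddCommGroup V] {A At : PBond P 0 → V} {κε : ℝ} (hκε : 0 ≤ κε)
    (hT2 : ∀ j', j' ≤ k → ∀ b ∈ (Sect2.regionOfSet P (cover P '' cube P.L a M ρ k j')).bonds, ‖A b‖ < κε * (P.L : ℝ) ^ (k - j'))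
    (hin : ∀ b ∈ (Sect2.regionOfSet P (cover P '' cube P.L a M ρ k 0)).bonds, At b = A b)
    (hout : ∀ b ∉ (Sect2.regionOfSet P (cover P '' cube P.L a M ρ k 0)).bonds, At b = 0) :
    (∀ b : PBond P 0, w 1 b * ‖At b‖ ≤ κε * P.L) ∧
      (∀ (b : PBond P 0) (ν : Fin P.d), w 2 b * ‖At ⟨b.src.shift ν, b.dir⟩ - At b‖ ≤ 2 * (κε * P.L)) :=
  truncation_rows_of_T2_aux hρ _ (fun x => (inOm_cube_levOf (a := a) (M := M) (ρ := ρ) (hk := hk) D₂ x).1)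
    (fun x => (inOm_cube_levOf (a := a) (M := M) (ρ := ρ) (hk := hk) D₂ x).2) hw hκε hT2 hin hout

/-! ## §3  The (153) slice rows pass from `A` to the truncation -/

/-- ★★ **`R∂*` OF ANY REAL ROW AGREEING WITH `A`'s ON `(regionOfSet (π″□₀)).bonds` EQUALS THAT OF `A`** (tower `1 ≤ k`, `ρ ≥ 2`; e.g. the truncation `Ã`): the difference is carried by bonds with an end off `π″□₀`, whose site stencils are
pinned (MODULE 106 `siteStencil_pinned_of_not_reach`), so MODULE 76 `RE_dsE_eq_zero_of_pinned_sites` kills it. [cite: Balaban1985Variational, (153) p.301; Balaban1984PropagatorsII, (2.9)–(2.12) pp.224–225] -/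
theorem RE_dsE_truncation_eq (D₂ : Domains P) (hk1 : 1 ≤ k) (hρ : 2 ≤ ρ) (c : ℝ) (f ft : PBond P 0 → ℝ)
    (hin : ∀ b ∈ (Sect2.regionOfSet P (cover P '' cube P.L a M ρ k 0)).bonds, ft b = f b) :
    RE (domainsMeet (cubeDomains P a M ρ k hk) D₂) c (dsE c (WithLp.toLp 2 ft : BondSpace P)) =
      RE (domainsMeet (cubeDomains P a M ρ k hk) D₂) c (dsE c (WithLp.toLp 2 f : BondSpace P)) := by
  -- `ft = f + (ft − f)`, the difference carried off `R₀`
  have hsplit : (WithLp.toLp 2 ft : BondSpace P) = (WithLp.toLp 2 f : BondSpace P) + (WithLp.toLp 2 (ft - f) : BondSpace P) := by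
    rw [← WithLp.toLp_add]; congr 1; abel
  have hzero : RE (domainsMeet (cubeDomains P a M ρ k hk) D₂) c (dsE c (WithLp.toLp 2 (ft - f) : BondSpace P)) = 0 := by
    refine RE_dsE_eq_zero_of_pinned_sites _ c fun b hb x hx => ?_
    have hb' : b ∉ (Sect2.regionOfSet P (cover P '' cube P.L a M ρ k 0)).bonds := by
      intro hmem
      apply hb
      show (ft - f) b = 0
      rw [Pi.sub_apply, hin b hmem, sub_self]
    exact siteStencil_pinned_of_not_reach D₂ hk1 hρ hb' x hx
  rw [hsplit, map_add, map_add, hzero, add_zero]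

end Summit.QuantumFields.YangMills.BalabanUVNodes.N07DPrimeTruncationRows

end
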